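import Summits.AnomalousDissipation.AnomalousDissipation.Theorems.KolmogorovFloor.Negative.CheapBaseKill
import Summits.AnomalousDissipation.AnomalousDissipation.Theorems.KolmogorovFloor.Negative.BelowTaylorSupport
import Summits.AnomalousDissipation.AnomalousDissipation.Theorems.KolmogorovFloor.Negative.Rest

/-!
# Smooth quiet Euler points kill every band-limited floor of resolution `N ≤ Cν^{-β}`, `β < 1`
# (negative side of `KolmogorovFloor`, stmt-14030; the dependency on crux `SmoothEulerCoerciveForce`)

cdisprove seat `refuter-cdisprove-stmt-AnomalousDissipation-14030-0` (2026-08-16). KERNEL-CHECKED form of the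
QUIET-POINT BEAT (Cruxes/TaylorCertificatePair/QUIET-POINT-BEAT-r2-6.md §2; `QuietPointBeat` of
`Cruxes/TaylorCertificatePair/QuietPointBeat-r2-6.lean` is the case `β = 1/2`), for the whole sub-dissipative
range `β < 1` (`floor_no_quiet_point`): if a smooth solenoidal mean-zero `v` is a weak steady solution of the
FORCED EULER equations with force `f` (`∫⟪(v·∇)v − f, w⟫ = 0` for all smooth solenoidal mean-zero `w`), then NO
floor family `∀ ν < ν₀ ∃ N ≤ Cν^{-β}, Φ₁ (band-limited by N), θ₁ ∈ [−Θ, 0], FLOOR ≥ ε₀ on the finite-enstrophy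
Leray ball` exists for `f`, whatever `ε₀ > 0, C, Θ, ν₀`. In particular (`β = 3/4`) EVERY WITNESS FORCE OF
`KolmogorovFloor` HAS NO SMOOTH QUIET EULER POINT (`kolmogorovFloor_witness_no_quiet_point`) — the crux implies
the Euler-coercivity property of crux #6 for its own force, and is killed by every designer force
`f = P[(v·∇)v]` (Taylor–Green, two-Beltrami products, …). Proof: `v` is a cheap base with defect `η = 0`
(`Negative/CheapBaseKill.lean :: cheap_base_kill`): work `(v, f) = ((v·∇)v, v) = 0`, drift slope
`Σ|k|‖v̂(k)‖ < ∞`, so `den = 4π²ν·S_v` and `den · Π ≍ ν^{2−2β} → 0`.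
-/

noncomputable section

open MeasureTheory UnitAddTorus Matrix
open scoped InnerProductSpace ENNReal ComplexConjugate

namespace Summit.AnomalousDissipation.AnomalousDissipation.Theorems.KolmogorovFloor.Negative

open Literature.Analysis.FunctionSpaces Literature.Analysis.FluidPDE
open Summit.AnomalousDissipation.AnomalousDissipation.Theorems.TaylorCertificatePair.Negative


/-- `ν² · ν^{-2β} = ν^{2 − 2β}`. -/
theorem sq_mul_rpow_neg_two_mul {ν β : ℝ} (hν : 0 < ν) : ν ^ 2 * ν ^ (-(2 * β)) = ν ^ (2 - 2 * β) := by
  rw [show (2 - 2 * β : ℝ) = 2 + (-(2 * β)) by ring, Real.rpow_add hν, Real.rpow_two]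

set_option maxHeartbeats 400000 in
/-- **Smooth quiet Euler points kill every band-limited floor of exponent `β < 1`** (module docstring). -/
theorem floor_no_quiet_point {β : ℝ} (hβ : β < 1)
    {f v : (UnitAddTorus (Fin 3)) → (EuclideanSpace ℝ (Fin 3))} (hf : Torus.IsSmooth f) (hv : Torus.IsSmooth v) (hvd : Torus.IsDivFree v) (hvz : Torus.HasZeroMean v)
    (hquiet : ∀ w : (UnitAddTorus (Fin 3)) → (EuclideanSpace ℝ (Fin 3)), Torus.IsSmooth w → Torus.IsDivFree w → Torus.HasZeroMean w →
      ∫ x, ⟪Torus.convect v v x - f x, w x⟫_ℝ = 0)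
    {ε₀ C Θ ν₀ : ℝ} (hε₀ : 0 < ε₀) (hν₀ : 0 < ν₀)
    (hfloor : ∀ ν : ℝ, 0 < ν → ν < ν₀ →
      ∃ (N : ℕ) (Φ₁ : Torus.CylindricalTest (Fin 3)) (θ₁ : ℝ), (N : ℝ) ≤ C * ν ^ (-β) ∧
        (∀ i, Torus.fourierTruncate N (Φ₁.g i) = Φ₁.g i) ∧ -Θ ≤ θ₁ ∧ θ₁ ≤ 0 ∧
        ∀ u : Torus.energySpace (Fin 3),
          let uf : (UnitAddTorus (Fin 3)) → (EuclideanSpace ℝ (Fin 3)) := ((u : (Lp (EuclideanSpace ℝ (Fin 3)) 2 (volume : Measure (UnitAddTorus (Fin 3))))) : (UnitAddTorus (Fin 3)) → (EuclideanSpace ℝ (Fin 3)));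
          let D : ℝ := ν * (Torus.eGradNormSq uf).toReal;
          let P : ℝ := Torus.pairing (u : (Lp (EuclideanSpace ℝ (Fin 3)) 2 (volume : Measure (UnitAddTorus (Fin 3))))) f - D;
          Torus.eGradNormSq uf ≠ ⊤ → ‖u‖ ^ 2 ≤ 16 * (∫ x, ‖f x‖ ^ 2) / ν ^ 2 →
            ε₀ ≤ D + Torus.nsGeneratorPairing ν f u (Φ₁.grad u) + 2 * θ₁ * P) :
    False := by
  have hF2nn : 0 ≤ ∫ x, ‖f x‖ ^ 2 := integral_nonneg fun x => by positivity
  /- a vanishing force has no floor datum at all -/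
  by_cases hF0 : ∫ x, ‖f x‖ ^ 2 = 0
  · obtain ⟨N, Φ₁, θ₁, -, -, -, -, hu⟩ := hfloor (ν₀ / 2) (by positivity) (by linarith)
    have hinj := rest_injects (by positivity : (0 : ℝ) < ν₀ / 2) hu
    have hae := ae_zero_of_integral_sq_zero hf hF0
    have hzero : (∫ x, ⟪f x, Φ₁.grad 0 x⟫_ℝ) = 0 := by
      rw [← integral_zero (α := (UnitAddTorus (Fin 3))) (G := ℝ)]
      refine integral_congr_ae ?_
      filter_upwards [hae] with x hx
      simp [hx]
    linarith
  have hF2 : 0 < ∫ x, ‖f x‖ ^ 2 := lt_of_le_of_ne hF2nn (Ne.symm hF0)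
  /- constants of the quiet point -/
  obtain ⟨Ev, hEvdef⟩ : ∃ Ev : ℝ, Ev = (Torus.eGradNormSq v).toReal := ⟨_, rfl⟩
  have hEv0 : 0 ≤ Ev := by rw [hEvdef]; exact ENNReal.toReal_nonneg
  obtain ⟨Sv, hSvdef⟩ : ∃ Sv : ℝ, Sv = (∑' κ, ‖mFourierCoeff (EuclideanSpace.complexify ∘ v) κ‖) +
      ∑' κ, ‖mFourierCoeff (EuclideanSpace.complexify ∘ Torus.laplacian v) κ‖ := ⟨_, rfl⟩
  have hSv0 : 0 ≤ Sv := by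
    rw [hSvdef]; exact add_nonneg (tsum_nonneg fun _ => norm_nonneg _) (tsum_nonneg fun _ => norm_nonneg _)
  obtain ⟨V, hVdef⟩ : ∃ V : ℝ, V = ∫ x, ‖v x‖ ^ 2 := ⟨_, rfl⟩
  have hV0 : 0 ≤ V := by rw [hVdef]; exact integral_nonneg fun x => by positivity
  -- the work channel is closed: `(v, f) = ((v·∇)v, v) = 0`
  have hP : ∫ x, ⟪v x, f x⟫_ℝ = 0 := by
    have h2 := hquiet v hv hvd hvz
    have h3 : ∫ x, ⟪Torus.convect v v x - f x, v x⟫_ℝ =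
        (∫ x, ⟪Torus.convect v v x, v x⟫_ℝ) - ∫ x, ⟪v x, f x⟫_ℝ := by
      simp_rw [inner_sub_left]
      rw [integral_sub (((hv.convect hv).inner hv).integrable) ((hf.inner hv).integrable)]
      congr 1
      exact integral_congr_ae (ae_of_all _ fun x => real_inner_comm _ _)
    rw [h3, Torus.integral_inner_convect_self_eq_zero hv hvd] at h2
    linarith
  /- thresholds -/
  obtain ⟨Θ', hΘ'⟩ : ∃ Θ' : ℝ, Θ' = max Θ 0 := ⟨_, rfl⟩
  have hΘ'0 : 0 ≤ Θ' := by rw [hΘ']; exact le_max_right _ _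
  obtain ⟨C', hC'⟩ : ∃ C' : ℝ, C' = max C 1 := ⟨_, rfl⟩
  have hC'1 : 1 ≤ C' := by rw [hC']; exact le_max_right _ _
  obtain ⟨β', hβ'⟩ : ∃ β' : ℝ, β' = max β 0 := ⟨_, rfl⟩
  have hβ'0 : 0 ≤ β' := by rw [hβ']; exact le_max_right _ _
  have hβ'1 : β' < 1 := by rw [hβ']; exact max_lt hβ one_pos
  have hββ' : β ≤ β' := by rw [hβ']; exact le_max_left _ _
  obtain ⟨γ, hγdef⟩ : ∃ γ : ℝ, γ = 2 - 2 * β' := ⟨_, rfl⟩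
  have hγ : 0 < γ := by rw [hγdef]; linarith
  obtain ⟨K₂, hK₂def⟩ : ∃ K₂ : ℝ, K₂ = 3200 * Real.pi ^ 4 * (Sv + 1) * (1 + 2 * Θ') * C' ^ 2 := ⟨_, rfl⟩
  have hK₂ : 0 < K₂ := by rw [hK₂def]; positivity
  obtain ⟨ρ₁, hρ₁⟩ : ∃ ρ₁ : ℝ, ρ₁ = ε₀ / (16 * (1 + 2 * Θ') * (Ev + 1)) := ⟨_, rfl⟩
  have hρ₁0 : 0 < ρ₁ := by rw [hρ₁]; positivity
  obtain ⟨ρ₂, hρ₂⟩ : ∃ ρ₂ : ℝ, ρ₂ = ε₀ / (3 * K₂) := ⟨_, rfl⟩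
  have hρ₂0 : 0 < ρ₂ := by rw [hρ₂]; positivity
  obtain ⟨ρ₃, hρ₃⟩ : ∃ ρ₃ : ℝ, ρ₃ = 1 / (20 * Real.pi ^ 2 * (Sv + 1)) := ⟨_, rfl⟩
  have hρ₃0 : 0 < ρ₃ := by rw [hρ₃]; positivity
  obtain ⟨ρ₄, hρ₄⟩ : ∃ ρ₄ : ℝ, ρ₄ = 16 * (∫ x, ‖f x‖ ^ 2) / (2 * V + 8) := ⟨_, rfl⟩
  have hρ₄0 : 0 < ρ₄ := by rw [hρ₄]; positivity
  obtain ⟨m, hmdef⟩ : ∃ m : ℝ, m = min (min (min ν₀ 1) (min ρ₁ (ρ₂ ^ (1 / γ)))) (min ρ₃ ρ₄) := ⟨_, rfl⟩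
  have hm0 : 0 < m := by
    rw [hmdef]
    exact lt_min (lt_min (lt_min hν₀ one_pos) (lt_min hρ₁0 (Real.rpow_pos_of_pos hρ₂0 _))) (lt_min hρ₃0 hρ₄0)
  obtain ⟨ν, hνdef⟩ : ∃ ν : ℝ, ν = m / 2 := ⟨_, rfl⟩
  have hν : 0 < ν := by rw [hνdef]; positivity
  have hνm : ν < m := by rw [hνdef]; linarith
  have hm1 : m ≤ min (min ν₀ 1) (min ρ₁ (ρ₂ ^ (1 / γ))) := by rw [hmdef]; exact min_le_left _ _
  have hm2 : m ≤ min ρ₃ ρ₄ := by rw [hmdef]; exact min_le_right _ _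
  have hνν₀ : ν < ν₀ := hνm.trans_le ((hm1.trans (min_le_left _ _)).trans (min_le_left _ _))
  have hν1 : ν ≤ 1 := (hνm.trans_le ((hm1.trans (min_le_left _ _)).trans (min_le_right _ _))).le
  have hνρ₁ : ν ≤ ρ₁ := (hνm.trans_le ((hm1.trans (min_le_right _ _)).trans (min_le_left _ _))).le
  have hνρ₂ : ν ≤ ρ₂ ^ (1 / γ) := (hνm.trans_le ((hm1.trans (min_le_right _ _)).trans (min_le_right _ _))).le
  have hνρ₃ : ν ≤ ρ₃ := (hνm.trans_le (hm2.trans (min_le_left _ _))).le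
  have hνρ₄ : ν ≤ ρ₄ := (hνm.trans_le (hm2.trans (min_le_right _ _))).le
  /- the certificate at `ν` -/
  obtain ⟨N, Φ₁, θ₁, hN, hband, hθ₁, hθ₁', hu⟩ := hfloor ν hν hνν₀
  have hΘ : 0 ≤ Θ := by linarith only [hθ₁, hθ₁']
  have hΘeq : Θ' = Θ := by rw [hΘ']; exact max_eq_left hΘ
  rw [hΘeq] at hK₂def hρ₁
  have hN0 : (0 : ℝ) ≤ N := Nat.cast_nonneg N
  -- `N ≤ C' ν^{-β'}`
  have hνβ : ν ^ (-β) ≤ ν ^ (-β') :=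
    Real.rpow_le_rpow_of_exponent_ge hν hν1 (by linarith only [hββ'])
  have hνβ1 : 1 ≤ ν ^ (-β') := Real.one_le_rpow_of_pos_of_le_one_of_nonpos hν hν1 (by linarith only [hβ'0])
  have hN' : (N : ℝ) ≤ C' * ν ^ (-β') := by
    calc (N : ℝ) ≤ C * ν ^ (-β) := hN
      _ ≤ C' * ν ^ (-β) := mul_le_mul_of_nonneg_right (by rw [hC']; exact le_max_left _ _) (Real.rpow_nonneg hν.le _)
      _ ≤ C' * ν ^ (-β') := mul_le_mul_of_nonneg_left hνβ (by linarith only [hC'1])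
  have h4N : (((4 * N + 1 : ℕ)) : ℝ) ≤ 5 * (C' * ν ^ (-β')) := by
    push_cast
    have : (1 : ℝ) ≤ C' * ν ^ (-β') := one_le_mul_of_one_le_of_one_le hC'1 hνβ1
    linarith only [hN', this]
  have h4N0 : (0 : ℝ) ≤ (((4 * N + 1 : ℕ)) : ℝ) := Nat.cast_nonneg _
  have h4N2 : (((4 * N + 1 : ℕ)) : ℝ) ^ 2 ≤ 25 * C' ^ 2 * ν ^ (-(2 * β')) := by
    calc (((4 * N + 1 : ℕ)) : ℝ) ^ 2 ≤ (5 * (C' * ν ^ (-β'))) ^ 2 := pow_le_pow_left₀ h4N0 h4N 2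
      _ = 25 * C' ^ 2 * (ν ^ (-β') * ν ^ (-β')) := by ring
      _ = 25 * C' ^ 2 * ν ^ (-(2 * β')) := by rw [← Real.rpow_add hν]; ring_nf
  /- the numeric hypotheses of `cheap_base_kill` with `η = 0`, `P_a = 0` -/
  have h1 : (1 + 2 * Θ) * (ν * (4 * Ev)) + 2 * Θ * 0 ≤ ε₀ / 4 := by
    rw [mul_zero, add_zero]
    have hle : ν ≤ ε₀ / (16 * (1 + 2 * Θ) * (Ev + 1)) := by rw [← hρ₁]; exact hνρ₁
    rw [le_div_iff₀ (by positivity)] at hle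
    nlinarith only [hle, hEv0, hν, hΘ]
  have hνγ : ν ^ γ ≤ ρ₂ := rpow_le_of_le_root hν hρ₂0 hγ hνρ₂
  have h2 : (4 * Real.pi ^ 2 * ν * Sv + 0) * (32 * Real.pi ^ 2 * (1 + 2 * Θ) * ν * (((4 * N + 1 : ℕ)) : ℝ) ^ 2) ≤ ε₀ / 3 := by
    rw [add_zero]
    have hstep : (4 * Real.pi ^ 2 * ν * Sv) * (32 * Real.pi ^ 2 * (1 + 2 * Θ) * ν * (((4 * N + 1 : ℕ)) : ℝ) ^ 2) ≤
        (128 * Real.pi ^ 4 * Sv * (1 + 2 * Θ)) * (25 * C' ^ 2) * (ν ^ 2 * ν ^ (-(2 * β'))) := by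
      have hc : 0 ≤ 128 * Real.pi ^ 4 * Sv * (1 + 2 * Θ) * ν ^ 2 := by positivity
      calc (4 * Real.pi ^ 2 * ν * Sv) * (32 * Real.pi ^ 2 * (1 + 2 * Θ) * ν * (((4 * N + 1 : ℕ)) : ℝ) ^ 2)
          = (128 * Real.pi ^ 4 * Sv * (1 + 2 * Θ) * ν ^ 2) * (((4 * N + 1 : ℕ)) : ℝ) ^ 2 := by ring
        _ ≤ (128 * Real.pi ^ 4 * Sv * (1 + 2 * Θ) * ν ^ 2) * (25 * C' ^ 2 * ν ^ (-(2 * β'))) :=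
            mul_le_mul_of_nonneg_left h4N2 hc
        _ = (128 * Real.pi ^ 4 * Sv * (1 + 2 * Θ)) * (25 * C' ^ 2) * (ν ^ 2 * ν ^ (-(2 * β'))) := by ring
    rw [sq_mul_rpow_neg_two_mul hν, ← hγdef] at hstep
    have hK : (128 * Real.pi ^ 4 * Sv * (1 + 2 * Θ)) * (25 * C' ^ 2) ≤ K₂ := by
      have hc : 0 ≤ 3200 * Real.pi ^ 4 * (1 + 2 * Θ) * C' ^ 2 := by positivity
      calc (128 * Real.pi ^ 4 * Sv * (1 + 2 * Θ)) * (25 * C' ^ 2)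
          = 3200 * Real.pi ^ 4 * (1 + 2 * Θ) * C' ^ 2 * Sv := by ring
        _ ≤ 3200 * Real.pi ^ 4 * (1 + 2 * Θ) * C' ^ 2 * (Sv + 1) :=
            mul_le_mul_of_nonneg_left (by linarith only [hSv0]) hc
        _ = K₂ := by rw [hK₂def]; ring
    have hνγ0 : 0 ≤ ν ^ γ := Real.rpow_nonneg hν.le _
    calc _ ≤ (128 * Real.pi ^ 4 * Sv * (1 + 2 * Θ)) * (25 * C' ^ 2) * ν ^ γ := hstep
      _ ≤ K₂ * ν ^ γ := mul_le_mul_of_nonneg_right hK hνγ0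
      _ ≤ K₂ * ρ₂ := mul_le_mul_of_nonneg_left hνγ hK₂.le
      _ = ε₀ / 3 := by rw [hρ₂]; field_simp
  have h3 : 5 * (4 * Real.pi ^ 2 * ν * Sv + 0) ≤ 1 := by
    rw [add_zero]
    have hle : ν ≤ 1 / (20 * Real.pi ^ 2 * (Sv + 1)) := by rw [← hρ₃]; exact hνρ₃
    rw [le_div_iff₀ (by positivity)] at hle
    nlinarith only [hle, hSv0, hν, Real.pi_pos]
  have hball : 2 * (∫ x, ‖v x‖ ^ 2) + 8 ≤ 16 * (∫ x, ‖f x‖ ^ 2) / ν ^ 2 := by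
    rw [← hVdef]
    have hle : ν ≤ 16 * (∫ x, ‖f x‖ ^ 2) / (2 * V + 8) := by rw [← hρ₄]; exact hνρ₄
    rw [le_div_iff₀ (by positivity)] at hle
    rw [le_div_iff₀ (by positivity)]
    have hν2 : ν ^ 2 ≤ ν := by nlinarith only [hν, hν1]
    nlinarith only [hle, hν2, hV0]
  /- the kill -/
  refine cheap_base_kill hf hν Φ₁ hband hθ₁ hθ₁' hε₀ hv hvd hvz (Ea := Ev) (Sa := Sv) (Pa := 0) (η := 0)
    (by rw [hEvdef]) ?_ hSv0 (by rw [hP, abs_zero]) le_rfl ?_ h1 h2 h3 hball ?_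
  · rw [hSvdef]; exact slope_sum_le_tsum hv N
  · intro W M hW hWd hWz _ _
    rw [hquiet W hW hWd hWz, abs_zero, zero_mul]
  · intro u hfin hballu
    have h := hu u
    dsimp only at h
    exact h hfin hballu

/-- **Every witness force of `KolmogorovFloor` has no smooth quiet Euler point** (`β = 3/4`): for a smooth
solenoidal mean-zero steady weak Euler solution `v` with force `f`, the Kolmogorov-class floor family for `f`
is impossible. The crux therefore implies, for its own force, the Euler-coercivity property of crux
`SmoothEulerCoerciveForce`; every designer force `P[(v·∇)v]` is excluded. -/
theorem kolmogorovFloor_witness_no_quiet_point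
    {f v : (UnitAddTorus (Fin 3)) → (EuclideanSpace ℝ (Fin 3))} (hf : Torus.IsSmooth f) (hv : Torus.IsSmooth v) (hvd : Torus.IsDivFree v) (hvz : Torus.HasZeroMean v)
    (hquiet : ∀ w : (UnitAddTorus (Fin 3)) → (EuclideanSpace ℝ (Fin 3)), Torus.IsSmooth w → Torus.IsDivFree w → Torus.HasZeroMean w →
      ∫ x, ⟪Torus.convect v v x - f x, w x⟫_ℝ = 0)
    {ε₀ C Θ ν₀ : ℝ} (hε₀ : 0 < ε₀) (hν₀ : 0 < ν₀)
    (hfloor : ∀ ν : ℝ, 0 < ν → ν < ν₀ →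
      ∃ (N : ℕ) (Φ₁ : Torus.CylindricalTest (Fin 3)) (θ₁ : ℝ), (N : ℝ) ≤ C * ν ^ (-(3 / 4 : ℝ)) ∧
        (∀ i, Torus.fourierTruncate N (Φ₁.g i) = Φ₁.g i) ∧ -Θ ≤ θ₁ ∧ θ₁ ≤ 0 ∧
        ∀ u : Torus.energySpace (Fin 3),
          let uf : (UnitAddTorus (Fin 3)) → (EuclideanSpace ℝ (Fin 3)) := ((u : (Lp (EuclideanSpace ℝ (Fin 3)) 2 (volume : Measure (UnitAddTorus (Fin 3))))) : (UnitAddTorus (Fin 3)) → (EuclideanSpace ℝ (Fin 3)));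
          let D : ℝ := ν * (Torus.eGradNormSq uf).toReal;
          let P : ℝ := Torus.pairing (u : (Lp (EuclideanSpace ℝ (Fin 3)) 2 (volume : Measure (UnitAddTorus (Fin 3))))) f - D;
          Torus.eGradNormSq uf ≠ ⊤ → ‖u‖ ^ 2 ≤ 16 * (∫ x, ‖f x‖ ^ 2) / ν ^ 2 →
            ε₀ ≤ D + Torus.nsGeneratorPairing ν f u (Φ₁.grad u) + 2 * θ₁ * P) :
    False :=
  floor_no_quiet_point (β := 3 / 4) (by norm_num) hf hv hvd hvz hquiet hε₀ hν₀ hfloor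

/-- **Conditional kill of the crux by name**: if EVERY smooth solenoidal mean-zero force admits a smooth quiet
Euler point (the flexibility scenario under which crux `SmoothEulerCoerciveForce` is false), then
`KolmogorovFloor` is false. -/
theorem kolmogorovFloor_false_of_quiet_points
    (hflex : ∀ f : (UnitAddTorus (Fin 3)) → (EuclideanSpace ℝ (Fin 3)), Torus.IsSmooth f → Torus.IsDivFree f → Torus.HasZeroMean f →
      ∃ v : (UnitAddTorus (Fin 3)) → (EuclideanSpace ℝ (Fin 3)), Torus.IsSmooth v ∧ Torus.IsDivFree v ∧ Torus.HasZeroMean v ∧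
        ∀ w : (UnitAddTorus (Fin 3)) → (EuclideanSpace ℝ (Fin 3)), Torus.IsSmooth w → Torus.IsDivFree w → Torus.HasZeroMean w →
          ∫ x, ⟪Torus.convect v v x - f x, w x⟫_ℝ = 0) :
    ¬ Summit.AnomalousDissipation.AnomalousDissipation.Theses.TaylorCertificates.KolmogorovFloor := by
  rintro ⟨f, hfs, hfd, hfz, ε₀, C, Θ, ν₀, hε₀, hν₀, hfloor⟩
  obtain ⟨v, hv, hvd, hvz, hquiet⟩ := hflex f hfs hfd hfz
  exact kolmogorovFloor_witness_no_quiet_point hfs hv hvd hvz hquiet hε₀ hν₀ hfloor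

end Summit.AnomalousDissipation.AnomalousDissipation.Theorems.KolmogorovFloor.Negative
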